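import Literature.AlgebraicGeometry.GroupSchemes.AffineGroupSchemeHopfAlgebraRoundTrip
import Literature.AlgebraicGeometry.GroupSchemes.HopfIdealOfClosedSubgroup
import HarnessLib

/-!
# An affine group scheme is `Spec` of its Hopf algebra, as a GROUP scheme (Görtz–Wedhorn II §(27.2), Def. 27.6 — object half)

Layer `Literature/AlgebraicGeometry/GroupSchemes`, namespace `Literature.AlgebraicGeometry.GroupSchemes.AffineGroupScheme` (continues ★
`AffineGroupSchemeHopfAlgebra` p844646 — `Alg G`, `ptEquiv`, `groupLaw` —, ★ `HopfIdealClosedSubgroup` p844710 — `isoSpecOver G : G ≅ specOver R (Alg G)` —,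
★ `HopfIdealOfClosedSubgroup` — `ptEquiv_isoSpecOver_inv`, `ptEquiv_isoSpecOver_inv_comp_apply` —, ★ `AffineGroupSchemeOfHopfAlgebra` p845155 —
`grpObjOfHopfAlgebra`, `coord` — and ★ `AffineGroupSchemeHopfAlgebraRoundTrip` p845217).  THEOREMS ONLY (no definition, no instance, no notation,
no named fact, no `sorry`).  Cell `hodgecm-mathlib` (D-0151), programme P6 «MOD», HEART organ (g1) «scheme dress of Cartier duality», FILE 4 of the
B-p04 (g37) plan (input of the bidual `(G^D)^D ≅ G`: the target `G` must be identified with `Spec Γ(G)` AS A GROUP SCHEME).  Count-neutral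
Mathlib-side capital: HC_CM is proved only modulo the 7 printed citations until rung 0 closes; nothing here bears on it.

THE PRINT ([GortzWedhorn2023] §(27.2), (27.2.1), Def. 27.6, pp. 606–607): the group law of an affine group scheme `G = Spec A` IS the one defined
by the Hopf structure of `A`: `m^* = Δ`, `e^* = ε`, `i^* = S`.  In the tree's currency (`Alg.comap f = Γ(f)`):

* §1 the structure morphisms read on `Γ`: **`comap_mul_eq`** (`Γ(m) = (Γ(pr₁) ⊗ Γ(pr₂)) ∘ Δ : A → Γ(G × G)` — the comultiplication of ★
  `Alg.instHopfAlgebra` IS `m^*` read through the canonical `A ⊗ A → Γ(G ×_R G)`), **`comap_one_eq`** (`Γ(e) = η_{Γ(Spec R)} ∘ ε`),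
  **`comap_inv_eq`** (`Γ(i) = S`);
* §2 `coord_isoSpecOver_hom` (the coordinates of `G ≅ Spec A` are `id_A`) and HEAD **`isMonHom_isoSpecOver_hom`**: the canonical
  `isoSpecOver G : G ≅ Spec Γ(G, 𝒪_G)` is an isomorphism of GROUP objects when `Spec Γ(G)` carries ★ `grpObjOfHopfAlgebra R (Alg G)` (and so is its
  inverse, `isMonHom_isoSpecOver_inv`) — together with ★ `algSpecOverBialgEquiv` (p845217) this closes the loop «affine group schemes over `R`» ⇄
  «commutative Hopf `R`-algebras» on objects.

## References
* [GortzWedhorn2023] U. Görtz, T. Wedhorn, *Algebraic Geometry II* (2023), §(27.2), (27.2.1), Def. 27.6 (pp. 606–607).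
-/

set_option autoImplicit false

-- Mathlib's `Over`/`Scheme` APIs are stated across semireducible wrappers (as in the ★ `GroupSchemes/*` files).
set_option backward.isDefEq.respectTransparency false

universe u

open CategoryTheory CategoryTheory.Limits AlgebraicGeometry MonoidalCategory CartesianMonoidalCategory TensorProduct WithConv

noncomputable section

namespace Literature.AlgebraicGeometry.GroupSchemes

namespace AffineGroupScheme

open scoped MonObj

open Literature.AlgebraicGeometry.Motives Literature.NumberTheory.DiophantineGeometry

variable {R : Type u} [CommRing R] (G : SchemeOver R) [GrpObj G] [IsAffine G.left]

/-! ## §1 The structure morphisms of `G` read on `Γ`: `m^* = Δ`, `e^* = ε`, `i^* = S` -/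

omit [GrpObj G] in
/-- `G ×_R G` is affine (Mathlib: a pullback of affine schemes over an affine base). [cite: GortzWedhorn2023, §(27.2) (p. 606)] -/
theorem isAffine_tensorObj_left : IsAffine (G ⊗ G).left := by
  rw [Over.tensorObj_left]
  infer_instance

omit [GrpObj G] in
/-- **`Γ(w)` as the algebra map of a point**: for `w : G ×_R G → G`, `Γ(w) = ` the algebra map of the tautological point
`Spec Γ(G × G) ≅ G × G → G` (★ `ptEquiv_isoSpecOver_inv_comp_apply`). [cite: GortzWedhorn2023, §(27.2) (p. 606)] -/
theorem comap_eq_ptEquiv {W : SchemeOver R} [IsAffine W.left] (w : W ⟶ G) :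
    Alg.comap w = ptEquiv G (Alg W) ((isoSpecOver W).inv ≫ w) :=
  AlgHom.ext fun y => (ptEquiv_isoSpecOver_inv_comp_apply w y).symm

/-- **`Γ(m) = (Γ(pr₁) ⊗ Γ(pr₂)) ∘ Δ`**: the multiplication `m : G ×_R G → G` read on global sections is the comultiplication of
★ `Alg.instHopfAlgebra` followed by the canonical map `A ⊗_R A → Γ(G ×_R G)`, `a ⊗ b ↦ pr₁^*(a) · pr₂^*(b)` ([GortzWedhorn2023] (27.2.1): `Δ = m^*`).
[cite: GortzWedhorn2023, §(27.2) (27.2.1) (pp. 606–607)] -/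
theorem comap_mul_eq :
    Alg.comap μ[G] =
      (Algebra.TensorProduct.lift (Alg.comap (fst G G)) (Alg.comap (snd G G)) fun _ _ => .all _ _).comp
        (Bialgebra.comulAlgHom R (Alg G)) := by
  haveI := isAffine_tensorObj_left G
  have hμ : μ[G] = fst G G * snd G G := by rw [Hom.mul_def, lift_fst_snd, Category.id_comp]
  rw [comap_eq_ptEquiv, hμ, MonObj.comp_mul, ← groupLaw_mul_apply, CorepGroupLaw.mul_eq, ← comulAlgHom_alg_eq, ← comap_eq_ptEquiv,
    ← comap_eq_ptEquiv]

omit [GrpObj G] in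
/-- `Spec R` (the unit object) is affine. [cite: GortzWedhorn2023, §(27.2) (p. 606)] -/
theorem isAffine_tensorUnit_left : IsAffine (𝟙_ (SchemeOver R)).left := inferInstanceAs (IsAffine (Spec (CommRingCat.of R)))

/-- **`Γ(e) = η ∘ ε`**: the unit section `e : Spec R → G` read on global sections is the counit of ★ `Alg.instHopfAlgebra` followed by the
structure map `R → Γ(Spec R)` ([GortzWedhorn2023] (27.2.1): `ε = e^*`). [cite: GortzWedhorn2023, §(27.2) (27.2.1) (pp. 606–607)] -/
theorem comap_one_eq :
    Alg.comap η[G] = (Algebra.ofId R (Alg (𝟙_ (SchemeOver R)))).comp (Bialgebra.counitAlgHom R (Alg G)) := by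
  haveI := isAffine_tensorUnit_left (R := R)
  have hη : η[G] = (1 : 𝟙_ (SchemeOver R) ⟶ G) := by rw [Hom.one_def, toUnit_unit, Category.id_comp]
  rw [comap_eq_ptEquiv, hη, MonObj.comp_one, ← groupLaw_one, CorepGroupLaw.one_eq, ← counitAlgHom_alg_eq]

/-- **`Γ(i) = S`**: the inversion `i : G → G` read on global sections is the antipode of ★ `Alg.instHopfAlgebra`
([GortzWedhorn2023] (27.2.1): `S = i^*`). [cite: GortzWedhorn2023, §(27.2) (27.2.1) (pp. 606–607)] -/
theorem comap_inv_eq : Alg.comap ι[G] = (groupLaw G).antipodeAlgHom := by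
  rw [comap_eq_ptEquiv, GrpObj.inv_eq_inv, GrpObj.comp_inv, Category.comp_id, ← groupLaw_inv_apply, CorepGroupLaw.inv_eq,
    ptEquiv_isoSpecOver_inv, AlgHom.id_comp]

/-- `Γ(i)` as a linear map is Mathlib's `HopfAlgebra.antipode` of `Γ(G, 𝒪_G)`. [cite: GortzWedhorn2023, §(27.2) (27.2.1) (pp. 606–607)] -/
theorem toLinearMap_comap_inv_eq : (Alg.comap ι[G]).toLinearMap = HopfAlgebra.antipode R (A := Alg G) := by
  rw [comap_inv_eq, antipode_alg_eq]

/-! ## §2 `G ≅ Spec Γ(G, 𝒪_G)` is an isomorphism of group schemes -/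

omit [GrpObj G] in
/-- **The coordinates of `G ≅ Spec Γ(G)` are the identity**: `coord (isoSpecOver G).hom = id_{Γ(G)}` (Mathlib `Scheme.toSpecΓ_appTop`:
`Γ` of `G → Spec Γ(G)` is `Γ(Spec Γ(G)) ≅ Γ(G)`). [cite: GortzWedhorn2023, §(27.2) (p. 606)] -/
theorem coord_isoSpecOver_hom : coord (isoSpecOver G).hom = AlgHom.id R (Alg G) := by
  apply AlgHom.ext
  intro a
  change (isoSpecOver G).hom.left.appTop.hom ((algSpecOverEquiv (Alg G)).symm a) = a
  rw [isoSpecOver_hom_left, Scheme.isoSpec_hom, Scheme.toSpecΓ_appTop]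
  exact (algSpecOverEquiv (Alg G)).apply_symm_apply a

omit [GrpObj G] in
/-- **`coord (w ≫ isoSpecOver.hom) = Γ(w)`** for any `w : W → G`. [cite: GortzWedhorn2023, §(27.2) (p. 606)] -/
theorem coord_comp_isoSpecOver_hom {W : SchemeOver R} (w : W ⟶ G) :
    coord (w ≫ (isoSpecOver G).hom) = Alg.comap w := by
  rw [coord_comp, coord_isoSpecOver_hom, AlgHom.comp_id]

/-- **HEAD — `G ≅ Spec Γ(G, 𝒪_G)` is an isomorphism of GROUP schemes**: for an affine group object `G` of `SchemeOver R`, the canonical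
`isoSpecOver G` is a homomorphism when `Spec Γ(G)` carries the group structure of the Hopf algebra `Γ(G, 𝒪_G)` (★ `grpObjOfHopfAlgebra`) —
[GortzWedhorn2023] Def. 27.6: the group scheme `G` IS `Spec` of its Hopf algebra.  (`m` goes to convolution of the projections by
`comap_mul_eq`, `e` to the convolution unit by `comap_one_eq`.) [cite: GortzWedhorn2023, §(27.2) (27.2.1) and Definition 27.6 (pp. 606–607)] -/
theorem isMonHom_isoSpecOver_hom : letI := grpObjOfHopfAlgebra R (Alg G); IsMonHom (isoSpecOver G).hom := by
  letI := grpObjOfHopfAlgebra R (Alg G)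
  refine ⟨?_, ?_⟩
  · apply coord_injective
    have h1 : η[specOver R (Alg G)] = (1 : 𝟙_ (SchemeOver R) ⟶ specOver R (Alg G)) := by
      rw [Hom.one_def, toUnit_unit, Category.id_comp]
    rw [coord_comp_isoSpecOver_hom, comap_one_eq, h1, coord_one_eq, AlgHom.convOne_def, ofConv_toConv]
  · apply coord_injective
    have h2 : ((isoSpecOver G).hom ⊗ₘ (isoSpecOver G).hom) ≫ μ[specOver R (Alg G)] =
        (fst G G ≫ (isoSpecOver G).hom) * (snd G G ≫ (isoSpecOver G).hom) := by
      rw [Hom.mul_def, lift_fst_comp_snd_comp]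
    rw [coord_comp_isoSpecOver_hom, comap_mul_eq, h2, coord_mul_eq, coord_comp_isoSpecOver_hom, coord_comp_isoSpecOver_hom,
      AlgHom.convMul_def, ofConv_toConv, ofConv_toConv, ofConv_toConv, ← AlgHom.comp_assoc, Algebra.TensorProduct.lmul'_comp_map]

/-- … and so is its inverse `Spec Γ(G, 𝒪_G) ≅ G`. [cite: GortzWedhorn2023, §(27.2) (27.2.1) and Definition 27.6 (pp. 606–607)] -/
theorem isMonHom_isoSpecOver_inv : letI := grpObjOfHopfAlgebra R (Alg G); IsMonHom (isoSpecOver G).inv := by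
  letI := grpObjOfHopfAlgebra R (Alg G)
  haveI := isMonHom_isoSpecOver_hom G
  infer_instance

end AffineGroupScheme

end Literature.AlgebraicGeometry.GroupSchemes

end
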